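import Summits.FinalStateConjecture.FinalStateConjecture.Theorems.DissipativeFinalMotionsFinalEraGenericIsometryTransport
import HarnessLib

/-!
# Route DissipativeFinalMotions — crux `FinalEraGeneric` (stmt-FinalStateConjecture-17642), line `registered`:
# `∃`-forms of the per-datum properties of the registered relative stubs S2b₁ₐ / S2b₁ᵦ / S2b₂

`Theorems/DissipativeFinalMotionsFinalEraGenericIsometryTransport.lean` (p167166) transports the crux's FULL post-maximality
property (complete `𝓘⁺` ∧ `IsFinalEra₂` ∧ (R) ∧ (F) ∧ (F₀)) along isometries of developments and collapses its `∃ ∧ ∀`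
bundling. The registered relative stubs of skeleton rev 4 speak two WEAKER per-datum properties:

* the EXTERIOR-settled property of S2b₁ₐ `stub_exteriorEraAtCensoredData` — complete `𝓘⁺` ∧ `IsFinalEra₂` ∧ (F), no rays clause;
* the HONEST property of S2b₁ᵦ `stub_raysAlongSettledCurves` / S2b₂ `stub_eraNearNakedData` — complete `𝓘⁺` ∧ `IsFinalEra₂` ∧ (R) ∧ (F).

This file records the same two facts for each of them (no named fact): transport along an isometry of vacuum Cauchy
developments (`exteriorEra_transport`, `honestEra_transport`) and the unconditional collapse of the `∃ ∧ ∀` bundling by MGHD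
uniqueness (`exteriorEraProperty_iff_exists`, `honestEraProperty_iff_exists`): in each case "an MGHD exists AND every MGHD has
the property" ↔ "SOME MGHD has the property". So when the planner promotes S2b₁ₐ (advice of leads c3–c8) its hypothesis
"one MGHD of the censored datum lacks an oriented era" and its conclusion "every MGHD of each small member carries one" may
both be read at ONE maximal development. Helper lemmas (`--supports`); they close nothing. References: Choquet-Bruhat–Geroch,
CMP 14 (1969), Thm. 3; Ringström 2009, Thm. 16.6; O'Neill 1983, Ch. 5 p. 145; Dafermos–Luk arXiv:1710.01722, Conjecture 1.
-/

noncomputable section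

-- `<Problem> = <Summit>` doubles the namespace component (tree-wide convention)
set_option linter.dupNamespace false

open Set Filter Topology Function
open scoped Manifold ContDiff Topology
open Literature.Geometry.Lorentzian

namespace Summit.FinalStateConjecture.FinalStateConjecture.Theorems.DissipativeFinalMotions.FinalEraGeneric

open Summit.FinalStateConjecture.FinalStateConjecture.Theorems.PhaseMixingCapture.WeakCosmicCensorshipMGHD
  (hasCompleteNullInfinity_iff_of_isIsometricTo)
open Summit.FinalStateConjecture.FinalStateConjecture.Theorems.EIHFluxBalance.TameTemplate
  (stub_raysStayInClosure_transport stub_rayTransport)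

section Transport

variable {X : Type} [TopologicalSpace X] [ChartedSpace E3 X] [IsManifold (𝓡 3) ∞ X] [T2Space X]
  [SecondCountableTopology X] [ConnectedSpace X] {D : InitialDataSet (𝓡 3) X}

omit [T2Space X] [SecondCountableTopology X] in
/-- **The exterior-settled property (S2b₁ₐ's: complete `𝓘⁺`, rev-2 era, (F); no rays clause) is transported along
an isometry of vacuum Cauchy developments** (`isFinalEra₂_transport`; scri by `hasCompleteNullInfinity_iff_of_isIsometricTo`;
(F) by the chain rule and the timecone lemma). [cite: Ringstrom2009, Thm. 16.6] -/
theorem exteriorEra_transport (𝒟₁ 𝒟₂ : VacuumCauchyDevelopment D)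
    (hI : 𝒟₁.toCauchyDevelopment.IsIsometricTo 𝒟₂.toCauchyDevelopment)
    (h₁ : Summit.FinalStateConjecture.HasCompleteNullInfinity 𝒟₁.toCauchyDevelopment ∧
      ∃ (N : ℕ) (M a : Fin N → ℝ) (T δ V C₁ C₂ ρ₀ κ : ℝ) (ξ : Fin N → ℝ → EuclideanSpace ℝ (Fin 3))
        (β : ℝ → ℝ) (U₀ : TopologicalSpace.Opens E4) (B₀ : ModelBackground) (B : Fin N → ModelBackground)
        (Ψ₀ : B₀.domain → 𝒟₁.carrier) (Ψ : (i : Fin N) → (B i).domain → 𝒟₁.carrier) (O : Set 𝒟₁.carrier),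
        𝒟₁.toCauchyDevelopment.IsFinalEra₂ N M a T δ V C₁ C₂ ρ₀ κ ξ β U₀ B₀ B Ψ₀ Ψ O ∧
          ∀ i (ρ : ℝ), ∀ᶠ τ in atTop, ∀ x ∈ (B i).truncTimeSlab ρ τ,
            𝒟₁.toSpacetime.timeOrientation.IsFutureDirected
              (mfderiv 𝓘(ℝ, E4) (𝓡 4) (Ψ i) x (Kerr.timeVector (M i) (a i) x.1))) :
    Summit.FinalStateConjecture.HasCompleteNullInfinity 𝒟₂.toCauchyDevelopment ∧
      ∃ (N : ℕ) (M a : Fin N → ℝ) (T δ V C₁ C₂ ρ₀ κ : ℝ) (ξ : Fin N → ℝ → EuclideanSpace ℝ (Fin 3))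
        (β : ℝ → ℝ) (U₀ : TopologicalSpace.Opens E4) (B₀ : ModelBackground) (B : Fin N → ModelBackground)
        (Ψ₀ : B₀.domain → 𝒟₂.carrier) (Ψ : (i : Fin N) → (B i).domain → 𝒟₂.carrier) (O : Set 𝒟₂.carrier),
        𝒟₂.toCauchyDevelopment.IsFinalEra₂ N M a T δ V C₁ C₂ ρ₀ κ ξ β U₀ B₀ B Ψ₀ Ψ O ∧
          ∀ i (ρ : ℝ), ∀ᶠ τ in atTop, ∀ x ∈ (B i).truncTimeSlab ρ τ,
            𝒟₂.toSpacetime.timeOrientation.IsFutureDirected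
              (mfderiv 𝓘(ℝ, E4) (𝓡 4) (Ψ i) x (Kerr.timeVector (M i) (a i) x.1)) := by
  obtain ⟨hcni, N, M, a, T, δ, V, C₁, C₂, ρ₀, κ, ξ, β, U₀, B₀, B, Ψ₀, Ψ, O, hera, hF⟩ := h₁
  refine ⟨(hasCompleteNullInfinity_iff_of_isIsometricTo _ _ hI).1 hcni, ?_⟩
  obtain ⟨ψ, hiso, hτ, hι⟩ := hI
  exact ⟨N, M, a, T, δ, V, C₁, C₂, ρ₀, κ, ξ, β, U₀, B₀, B, ψ ∘ Ψ₀, fun i ↦ ψ ∘ Ψ i, ψ '' O,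
    isFinalEra₂_transport 𝒟₁.toCauchyDevelopment 𝒟₂.toCauchyDevelopment ψ hiso hτ hι hera,
    fun i ρ ↦ (hF i ρ).mono fun τ hτ' x hx ↦
      isFutureDirected_mfderiv_comp 𝒟₁.toCauchyDevelopment 𝒟₂.toCauchyDevelopment ψ hiso hτ
        (hera.2.2.2.2.2.2.2.2.2.2.2.2.2.2.2.2.2.2.2.2.1 i).contMDiff (hτ' x hx)⟩

/-- **The honest property (S2b₁ᵦ's / S2b₂'s: complete `𝓘⁺`, rev-2 era, (R), (F); no (F₀)) is transported along an
isometry of vacuum Cauchy developments** ((R) by the ray correspondence `stub_rayTransport` and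
`stub_raysStayInClosure_transport`). [cite: Ringstrom2009, Thm. 16.6] -/
theorem honestEra_transport (𝒟₁ 𝒟₂ : VacuumCauchyDevelopment D)
    (hI : 𝒟₁.toCauchyDevelopment.IsIsometricTo 𝒟₂.toCauchyDevelopment)
    (h₁ : Summit.FinalStateConjecture.HasCompleteNullInfinity 𝒟₁.toCauchyDevelopment ∧
      ∃ (N : ℕ) (M a : Fin N → ℝ) (T δ V C₁ C₂ ρ₀ κ : ℝ) (ξ : Fin N → ℝ → EuclideanSpace ℝ (Fin 3))
        (β : ℝ → ℝ) (U₀ : TopologicalSpace.Opens E4) (B₀ : ModelBackground) (B : Fin N → ModelBackground)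
        (Ψ₀ : B₀.domain → 𝒟₁.carrier) (Ψ : (i : Fin N) → (B i).domain → 𝒟₁.carrier) (O : Set 𝒟₁.carrier),
        𝒟₁.toCauchyDevelopment.IsFinalEra₂ N M a T δ V C₁ C₂ ρ₀ κ ξ β U₀ B₀ B Ψ₀ Ψ O ∧
          Summit.FinalStateConjecture.RaysStayInClosure 𝒟₁.toCauchyDevelopment O ∧
            ∀ i (ρ : ℝ), ∀ᶠ τ in atTop, ∀ x ∈ (B i).truncTimeSlab ρ τ,
              𝒟₁.toSpacetime.timeOrientation.IsFutureDirected
                (mfderiv 𝓘(ℝ, E4) (𝓡 4) (Ψ i) x (Kerr.timeVector (M i) (a i) x.1))) :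
    Summit.FinalStateConjecture.HasCompleteNullInfinity 𝒟₂.toCauchyDevelopment ∧
      ∃ (N : ℕ) (M a : Fin N → ℝ) (T δ V C₁ C₂ ρ₀ κ : ℝ) (ξ : Fin N → ℝ → EuclideanSpace ℝ (Fin 3))
        (β : ℝ → ℝ) (U₀ : TopologicalSpace.Opens E4) (B₀ : ModelBackground) (B : Fin N → ModelBackground)
        (Ψ₀ : B₀.domain → 𝒟₂.carrier) (Ψ : (i : Fin N) → (B i).domain → 𝒟₂.carrier) (O : Set 𝒟₂.carrier),
        𝒟₂.toCauchyDevelopment.IsFinalEra₂ N M a T δ V C₁ C₂ ρ₀ κ ξ β U₀ B₀ B Ψ₀ Ψ O ∧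
          Summit.FinalStateConjecture.RaysStayInClosure 𝒟₂.toCauchyDevelopment O ∧
            ∀ i (ρ : ℝ), ∀ᶠ τ in atTop, ∀ x ∈ (B i).truncTimeSlab ρ τ,
              𝒟₂.toSpacetime.timeOrientation.IsFutureDirected
                (mfderiv 𝓘(ℝ, E4) (𝓡 4) (Ψ i) x (Kerr.timeVector (M i) (a i) x.1)) := by
  obtain ⟨hcni, N, M, a, T, δ, V, C₁, C₂, ρ₀, κ, ξ, β, U₀, B₀, B, Ψ₀, Ψ, O, hera, hR, hF⟩ := h₁
  refine ⟨(hasCompleteNullInfinity_iff_of_isIsometricTo _ _ hI).1 hcni, ?_⟩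
  obtain ⟨ψ, hiso, hτ, hι⟩ := hI
  exact ⟨N, M, a, T, δ, V, C₁, C₂, ρ₀, κ, ξ, β, U₀, B₀, B, ψ ∘ Ψ₀, fun i ↦ ψ ∘ Ψ i, ψ '' O,
    isFinalEra₂_transport 𝒟₁.toCauchyDevelopment 𝒟₂.toCauchyDevelopment ψ hiso hτ hι hera,
    stub_raysStayInClosure_transport X D 𝒟₁ 𝒟₂ ψ hiso hτ hι
      (fun p γ dom ↦ stub_rayTransport X D 𝒟₁ 𝒟₂ ψ hiso hτ hι p γ dom) O hR,
    fun i ρ ↦ (hF i ρ).mono fun τ hτ' x hx ↦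
      isFutureDirected_mfderiv_comp 𝒟₁.toCauchyDevelopment 𝒟₂.toCauchyDevelopment ψ hiso hτ
        (hera.2.2.2.2.2.2.2.2.2.2.2.2.2.2.2.2.2.2.2.2.1 i).contMDiff (hτ' x hx)⟩

omit [T2Space X] [SecondCountableTopology X] in
/-- **`∃ ∧ ∀` collapse for the exterior-settled property** (the conclusion property of S2b₁ₐ, and — negated at the
base datum — its hypothesis): "an MGHD exists AND every MGHD has complete `𝓘⁺` and an oriented rev-2 era" ↔ "SOME MGHD
has complete `𝓘⁺` and an oriented rev-2 era" (`mghd_unique_cauchy` + `exteriorEra_transport`).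
[cite: ChoquetBruhatGeroch1969CMP, Thm. 3 (pp. 332–334)] -/
theorem exteriorEraProperty_iff_exists (D : InitialDataSet (𝓡 3) X) :
    ((∃ 𝒟 : VacuumCauchyDevelopment D, 𝒟.IsMaximal) ∧
      ∀ 𝒟 : VacuumCauchyDevelopment D, 𝒟.IsMaximal →
        Summit.FinalStateConjecture.HasCompleteNullInfinity 𝒟.toCauchyDevelopment ∧
          ∃ (N : ℕ) (M a : Fin N → ℝ) (T δ V C₁ C₂ ρ₀ κ : ℝ) (ξ : Fin N → ℝ → EuclideanSpace ℝ (Fin 3))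
            (β : ℝ → ℝ) (U₀ : TopologicalSpace.Opens E4) (B₀ : ModelBackground)
            (B : Fin N → ModelBackground) (Ψ₀ : B₀.domain → 𝒟.carrier)
            (Ψ : (i : Fin N) → (B i).domain → 𝒟.carrier) (O : Set 𝒟.carrier),
            𝒟.toCauchyDevelopment.IsFinalEra₂ N M a T δ V C₁ C₂ ρ₀ κ ξ β U₀ B₀ B Ψ₀ Ψ O ∧
              ∀ i (ρ : ℝ), ∀ᶠ τ in atTop, ∀ x ∈ (B i).truncTimeSlab ρ τ,
                𝒟.toSpacetime.timeOrientation.IsFutureDirected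
                  (mfderiv 𝓘(ℝ, E4) (𝓡 4) (Ψ i) x (Kerr.timeVector (M i) (a i) x.1))) ↔
      ∃ 𝒟 : VacuumCauchyDevelopment D, 𝒟.IsMaximal ∧
        (Summit.FinalStateConjecture.HasCompleteNullInfinity 𝒟.toCauchyDevelopment ∧
          ∃ (N : ℕ) (M a : Fin N → ℝ) (T δ V C₁ C₂ ρ₀ κ : ℝ) (ξ : Fin N → ℝ → EuclideanSpace ℝ (Fin 3))
            (β : ℝ → ℝ) (U₀ : TopologicalSpace.Opens E4) (B₀ : ModelBackground)
            (B : Fin N → ModelBackground) (Ψ₀ : B₀.domain → 𝒟.carrier)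
            (Ψ : (i : Fin N) → (B i).domain → 𝒟.carrier) (O : Set 𝒟.carrier),
            𝒟.toCauchyDevelopment.IsFinalEra₂ N M a T δ V C₁ C₂ ρ₀ κ ξ β U₀ B₀ B Ψ₀ Ψ O ∧
              ∀ i (ρ : ℝ), ∀ᶠ τ in atTop, ∀ x ∈ (B i).truncTimeSlab ρ τ,
                𝒟.toSpacetime.timeOrientation.IsFutureDirected
                  (mfderiv 𝓘(ℝ, E4) (𝓡 4) (Ψ i) x (Kerr.timeVector (M i) (a i) x.1))) := by
  constructor
  · rintro ⟨⟨𝒟, hmax⟩, hall⟩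
    exact ⟨𝒟, hmax, hall 𝒟 hmax⟩
  · rintro ⟨𝒟, hmax, hQ⟩
    exact ⟨⟨𝒟, hmax⟩, fun 𝒟' hmax' ↦ exteriorEra_transport 𝒟 𝒟' (mghd_unique_cauchy 𝒟 𝒟' hmax hmax') hQ⟩

/-- **`∃ ∧ ∀` collapse for the honest property** (the conclusion property of S2b₁ᵦ / S2b₂, and — negated at the base
datum — the hypothesis of S2b₁ᵦ): "an MGHD exists AND every MGHD has complete `𝓘⁺` and an honest oriented rev-2 era
with (R)" ↔ "SOME MGHD has it" (`mghd_unique_cauchy` + `honestEra_transport`).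
[cite: ChoquetBruhatGeroch1969CMP, Thm. 3 (pp. 332–334)] -/
theorem honestEraProperty_iff_exists : open scoped Manifold in ∀ (X : Type) [TopologicalSpace X] [ChartedSpace (EuclideanSpace ℝ (Fin 3)) X] [IsManifold (𝓡 3) ((⊤ : ℕ∞) : WithTop ℕ∞) X] [T2Space X] [SecondCountableTopology X] [ConnectedSpace X] (D : Literature.Geometry.Lorentzian.InitialDataSet (𝓡 3) X), ((∃ 𝒟 : Literature.Geometry.Lorentzian.VacuumCauchyDevelopment D, 𝒟.IsMaximal) ∧ ∀ 𝒟 : Literature.Geometry.Lorentzian.VacuumCauchyDevelopment D, 𝒟.IsMaximal → Summit.FinalStateConjecture.HasCompleteNullInfinity 𝒟.toCauchyDevelopment ∧ ∃ (N : ℕ) (M a : Fin N → ℝ) (T δ V C₁ C₂ ρ₀ κ : ℝ) (ξ : Fin N → ℝ → EuclideanSpace ℝ (Fin 3)) (β : ℝ → ℝ) (U₀ : TopologicalSpace.Opens Literature.Geometry.Lorentzian.E4) (B₀ : Literature.Geometry.Lorentzian.ModelBackground) (B : Fin N → Literature.Geometry.Lorentzian.ModelBackground) (Ψ₀ : B₀.domain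 → 𝒟.carrier) (Ψ : (i : Fin N) → (B i).domain → 𝒟.carrier) (O : Set 𝒟.carrier), 𝒟.toCauchyDevelopment.IsFinalEra₂ N M a T δ V C₁ C₂ ρ₀ κ ξ β U₀ B₀ B Ψ₀ Ψ O ∧ Summit.FinalStateConjecture.RaysStayInClosure 𝒟.toCauchyDevelopment O ∧ ∀ i (ρ : ℝ), ∀ᶠ τ in Filter.atTop, ∀ x ∈ (B i).truncTimeSlab ρ τ, 𝒟.toSpacetime.timeOrientation.IsFutureDirected (mfderiv 𝓘(ℝ, Literature.Geometry.Lorentzian.E4) (𝓡 4) (Ψ i) x (Literature.Geometry.Lorentzian.Kerr.timeVector (M i) (a i) x.1))) ↔ ∃ 𝒟 : Literature.Geometry.Lorentzian.VacuumCauchyDevelopment D, 𝒟.IsMaximal ∧ (Summit.FinalStateConjecture.HasCompleteNullInfinity 𝒟.toCauchyDevelopment ∧ ∃ (N : ℕ) (M a : Fin N → ℝ) (T δ V C₁ C₂ ρ₀ κ : ℝ) (ξ : Fin N → ℝ → EuclideanSpace ℝ (Fin 3)) (β : ℝ → ℝ) (U₀ : TopologicalSpace.Opens Literature.Geometry.Lorentzian.E4)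 (B₀ : Literature.Geometry.Lorentzian.ModelBackground) (B : Fin N → Literature.Geometry.Lorentzian.ModelBackground) (Ψ₀ : B₀.domain → 𝒟.carrier) (Ψ : (i : Fin N) → (B i).domain → 𝒟.carrier) (O : Set 𝒟.carrier), 𝒟.toCauchyDevelopment.IsFinalEra₂ N M a T δ V C₁ C₂ ρ₀ κ ξ β U₀ B₀ B Ψ₀ Ψ O ∧ Summit.FinalStateConjecture.RaysStayInClosure 𝒟.toCauchyDevelopment O ∧ ∀ i (ρ : ℝ), ∀ᶠ τ in Filter.atTop, ∀ x ∈ (B i).truncTimeSlab ρ τ, 𝒟.toSpacetime.timeOrientation.IsFutureDirected (mfderiv 𝓘(ℝ, Literature.Geometry.Lorentzian.E4) (𝓡 4) (Ψ i) x (Literature.Geometry.Lorentzian.Kerr.timeVector (M i) (a i) x.1))) := by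
  intro X _ _ _ _ _ _ D
  constructor
  · rintro ⟨⟨𝒟, hmax⟩, hall⟩
    exact ⟨𝒟, hmax, hall 𝒟 hmax⟩
  · rintro ⟨𝒟, hmax, hQ⟩
    exact ⟨⟨𝒟, hmax⟩, fun 𝒟' hmax' ↦ honestEra_transport 𝒟 𝒟' (mghd_unique_cauchy 𝒟 𝒟' hmax hmax') hQ⟩

end Transport

end Summit.FinalStateConjecture.FinalStateConjecture.Theorems.DissipativeFinalMotions.FinalEraGeneric

end
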